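import Literature.AnabelianGeometry.EtaleTheta.Discharge.Sec5OfConnectedTemperoid

/-!
# [EtTh] Prop. 5.2 (ii) — "the §1 actions ARE the bi-Kummer actions" — as a characterisation, and for the GENUINE §5 data over `B^temp(Π^tp_X)⁰` (p.324 / PDF p.98; kurims-ms p.89)

Mochizuki, *The étale theta function and its Frobenioid-theoretic manifestations*, Publ. RIMS **45** (2009), Prop. 5.2 (ii)
p.324 (PDF p.98) [kurims-ms p.89]: "The group actions of Proposition 1.1, (ii); Lemma 1.2, arising from '`s_{l·N}`', '`τ_{l·N}`',
respectively, are precisely the actions determined by the bi-Kummer `l·N`-th root [cf. Proposition 4.3, (i)] arising from the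
`l·N`-th root of (i)."  Printed proof (p.324 / kurims-ms p.90): "These assertions follow immediately from the definitions."
[cite: MochizukiEtTh2009, Prop 5.2 (ii) p.324 (PDF p.98)]
abc-iut cell, block C / wave W6 (cone provers), seat abc-iut-w6-d086, cone row `EtTh:Prop5.2(ii)` (plan/W6-TRANCHE-2.tsv; kernel DAG
alias `N_EtTh_Prop5_2_ii`).  PROOF-ONLY companion of abc-iut-L2-t4's FROZEN trunk `FrobenioidThetaBiKummer.lean` (p406884) and of the
W3-L2-01 genuine-data files (`FrobenioidThetaOfBiKummerData.lean`, `Discharge/Sec5OfConnectedTemperoid.lean`): no `def`, no new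
`Prop`, nothing landed is edited or restated; every input is a constructor argument of the data or a theorem cited BY NAME.

WHAT THE TREE HAD.  The node's decl `FrobenioidThetaBiKummer.ThetaPairActionsAgree 𝔉 actS actT` takes the two §1 actions —
rendered as homomorphisms `H_{B_N} → Aut_C(B_N)` — as PARAMETERS (its docstring: `TODO-merge(abc-iut-L2-t1)`; abc-iut-L2-t1's
`ThetaSetting.LineBundleData` / `Prop11ii` / `Lem12` (`ThetaTrivializations.lean`) carry the §1 actions over the ABSTRACT automorphism
groups `AutV`, `AutVdd` of an interface — formal schemes have no carrier, plan/FOUNDATIONS.md row 14 — with no map to `Aut_C(B_N)`;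
no Frobenioid incarnation of the §1 actions exists in the tree) and says `actS = s^⊓-gp_N|_{H_{B_N}} ∧ actT = s^⊔-gp_N`.  Kernel
facts before this file: universal closure REFUTED and the tautological instance `(s^⊓-gp_N|_H, s^⊔-gp_N)` PROVED (abc-iut-w6-d043,
`Discharge/Sec5BiKummerSchemaVerdicts.lean`: `not_forall_thetaPairActionsAgree`, `thetaPairActionsAgree_self`); the ABSTRACT instance
form at the printed hypotheses (abc-iut-f-126, `Discharge/Sec5Prop52InstanceForms.lean`, p432149 — cited, not imported: accepted but
unbuilt at filing time): over epimorphisms `s^⊓_N`, `s^⊔_N`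
satisfying the p.331 defining relations, `ThetaPairActionsAgree 𝔉 actS actT` ⟺ the supplied actions satisfy the SAME two relations
(`FrobenioidThetaBiKummer.thetaPairActionsAgree_iff_definingRelations`, by the uniqueness clause of Prop. 4.3 (i)).  At the genuine
data `s^⊓-gp_N`, `s^⊔-gp_N` ARE "the actions determined by the bi-Kummer root [Prop. 4.3 (i)]": the UNIQUE lifts of p.331
(`ThetaFrobenioid.ofRootData` via `liftAlong`), whose defining relations are THEOREMS (`sgpCapSpec_ofConnectedTemperoidData`,
`sgpCupSpec_ofConnectedTemperoidData`), in a totally epimorphic category ([FrdI] Thm. 5.2 for the model Frobenioid, `epi_of_model`).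

WHAT IS PROVED HERE — the characterisation INSTANTIATED at the genuine named instances, where all its hypotheses are theorems, plus
three small abstract complements.  Reading (print's proof: "follows immediately from the definitions" = UNIQUENESS):
in §1 both actions are DEFINED by compatibility with the morphism determined by the section — Prop. 1.1 (ii) "a unique action of
`Π^tp_X` on `L_N ⊗ O_{J_N}` … compatible with the morphism `Z_N → V(L_N ⊗ O_{J_N})` determined by `s_N`" (p.241 / kurims-ms p.14);
Lem. 1.2 "actions of `Π^tp_Y` (respectively, `Π^tp_Ÿ`) on `Ÿ_N`, `V(L̈_N)` which preserve `τ_N`" (p.245 / kurims-ms p.18) — and in the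
Frobenioid `C` of §5, where the pull-backs of `s_{l·N}`, `τ_{l·N}` "may be interpreted as morphisms `V(O_{Z̈_{l·N}}) → V(L̈_{l·N}|_{Z̈_{l·N}})`
— i.e., as morphisms between objects of `C`" (p.324 / kurims-ms p.89), namely `s^⊓_N, s^⊔_N : A_N → B_N`, an automorphism `β` of `B_N`
over `h ∈ H_{B_N}` is compatible with the morphism `s` determined by the section iff `s ≫ β = s^trv_N(h′) ≫ s` (`s^trv_N(h′)` the
automorphism of the trivial bundle `A_N` over the same base automorphism, p.331) — the "defining relations" below.
* abstract complements (any §5 datum): `ThetaFrobenioid.eq_sgpCap_of_comp_eq` — the FULL-GROUP form for the Prop. 1.1 (ii) action,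
  which "factors through `Π^tp_X/Π^tp_{Z_N} = Gal(Z_N/X)`" (here `Aut_D(B_N^bs)`, Def. 4.1 (ii)): any `a : Aut_D(B_N^bs) → Aut_C(B_N)`
  compatible with `s^⊓_N` IS `s^⊓-gp_N` (epi `s^⊓_N` + `SgpCapSpec`); `thetaPairActionsAgree_iff_definingRelations_of_totallyEpi`
  (the characterisation with total epimorphicity of `C` as the hypothesis, [FrdI] Def. 1.3 — the shape `epi_of_model` / `hepi`
  supply; abc-iut-f-126's `Epi`-instance form is the abstract statement of record) and `Facts.thetaPairActionsAgree_iff_definingRelations`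
  (the same over abc-iut-L2-t4's bundle `Facts` of §5 named inputs, whose fields `sgpCapSpec`, `sgpCupSpec`, `epi_sCap`, `epi_sCup`
  are exactly the hypotheses);
* `ThetaFrobenioid.thetaPairActionsAgree_ofBiKummerData_iff` / `…_of_definingRelations` — the characterisation for the ASSEMBLED §5
  data `ofBiKummerData` over any bi-Kummer setting, UNCONDITIONAL: total epimorphicity = [FrdI] Thm. 5.2 for the model Frobenioid
  (`epi_of_model` from `ModelFrobenioid.Hypotheses`), defining relations = abc-iut-L2-t4's `sgpCapSpec_ofBiKummerData` /
  `sgpCupSpec_ofBiKummerData`;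
* `ThetaFrobenioid.thetaPairActionsAgree_ofConnectedTemperoidData_iff` / `…_of_definingRelations` / `eq_sgpCap_ofConnectedTemperoidData_of_comp_eq`
  — **Prop. 5.2 (ii) for the §5 data over the GENUINE connected base `B^temp(Π^tp_X)⁰`** (`ofConnectedTemperoidData`;
  `s^trv_N = strvOfBiKummerData h R` constructed, `(s^⊓_N, s^⊔_N) = (R.pair.num, R.pair.den)`): the node's decl holds for EXACTLY
  the parameter pairs compatible with `s^⊓_N`, `s^⊔_N`; no named fact, no GAP-LEDGER row, no binder beyond the data's own
  constructor arguments.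
WHAT IS NOT PROVED (honest): the tree has no Frobenioid incarnation `actS`, `actT` of abc-iut-L2-t1's `LineBundleData` actions; this
file reduces Prop. 5.2 (ii) for ANY such incarnation to the two displayed compatibility equations — the §1 DEFINING properties read
in `C` — and does not construct the incarnation (L2 MERGE-PLAN row 5 / W3-L2-01).
HONEST FRAMING: kernel-checked consequences of abc-iut-L2-t4's typed statements for data so constructed; nothing of [EtTh] is asserted
unconditionally; a FACT row is an assumption label, not an endorsement; nothing here bears on [IUTchIII] Cor. 3.12 and no side is taken;
typed ≠ proved.
-/

noncomputable section

namespace Literature.AnabelianGeometry.EtaleTheta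

open CategoryTheory Opposite Literature.AlgebraicGeometry.Frobenioids Literature.AnabelianGeometry.SemiGraphs
  Literature.AnabelianGeometry.SemiGraphs.GaloisObjects FrobenioidThetaBiKummer

universe u₀ v₀ w v v' u u'

namespace ThetaFrobenioid

/-! ### Abstract complements (any §5 datum) to abc-iut-f-126's `thetaPairActionsAgree_iff_definingRelations` -/

section Generic

variable {C : Type u} [Category.{v} C] {D : Type u'} [Category.{v'} D] (𝔉 : ThetaFrobenioid.{w} C D)

/-- (full group) The Prop. 1.1 (ii) action "factors through `Π^tp_X/Π^tp_{Z_N} = Gal(Z_N/X)`" (p.241 (PDF p.15)), i.e. through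
`Aut_D(B_N^bs)` (Def. 4.1 (ii)): ANY homomorphism `a : Aut_D(B_N^bs) → Aut_C(B_N)` compatible with the morphism `s^⊓_N` determined by
`s_{l·N}` (`s^⊓_N ≫ a(g) = s^trv_N(g′) ≫ s^⊓_N`) IS `s^⊓-gp_N` — p.331 (PDF p.105) "determines unique group homomorphisms", by total
epimorphicity ([FrdI] Def. 1.3); the first half of abc-iut-L2-t4's `sgpUnique_of`, stated on its own.
[cite: MochizukiEtTh2009, Prop 5.2 (ii) p.324 (PDF p.98); §5 p.331 (PDF p.105)] -/
theorem eq_sgpCap_of_comp_eq [Epi 𝔉.sCap] (hcap : 𝔉.SgpCapSpec) (a : Aut (𝔉.base.obj 𝔉.BN) →* Aut 𝔉.BN)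
    (ha : ∀ g : Aut (𝔉.base.obj 𝔉.BN), 𝔉.sCap ≫ (a g).hom = (𝔉.strv (𝔉.autBaseIsoAB.symm g)).hom ≫ 𝔉.sCap) :
    a = 𝔉.sgpCap := by
  ext g : 1
  apply Aut.ext
  exact (cancel_epi 𝔉.sCap).mp ((ha g).trans (hcap g).symm)

/-- **Prop. 5.2 (ii) as a characterisation, total-epimorphicity form**: in a totally epimorphic `C` ([FrdI] Def. 1.3 — the form the
§5 constructors supply, `epi_of_model` / `hepi`) whose `s^⊓-gp_N`, `s^⊔-gp_N` satisfy the p.331 defining relations, a pair of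
`H_{B_N}`-actions on `B_N` agrees with `(s^⊓-gp_N|_{H_{B_N}}, s^⊔-gp_N)` IFF it is compatible with the morphisms `s^⊓_N`, `s^⊔_N`
determined by `s_{l·N}`, `τ_{l·N}` (uniqueness clause of Prop. 4.3 (i), "determines unique group homomorphisms").  The `Epi`-instance
form of this equivalence is abc-iut-f-126's `FrobenioidThetaBiKummer.thetaPairActionsAgree_iff_definingRelations`
(`Discharge/Sec5Prop52InstanceForms.lean`, p432149 — the abstract form of record; not imported here only because its module was
accepted-but-unbuilt at filing time; the three-line uniqueness argument is repeated at this hypothesis shape).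
[cite: MochizukiEtTh2009, Prop 5.2 (ii) p.324 (PDF p.98); §5 p.331 (PDF p.105)] -/
theorem thetaPairActionsAgree_iff_definingRelations_of_totallyEpi (hepi : ∀ ⦃X Y : C⦄ (f : X ⟶ Y), Epi f)
    (hcap : 𝔉.SgpCapSpec) (hcup : 𝔉.SgpCupSpec) (actS actT : 𝔉.HB →* Aut 𝔉.BN) :
    ThetaPairActionsAgree 𝔉 actS actT ↔
      (∀ h : 𝔉.HB, 𝔉.sCap ≫ (actS h).hom = (𝔉.strv (𝔉.autBaseIsoAB.symm (h : Aut (𝔉.base.obj 𝔉.BN)))).hom ≫ 𝔉.sCap) ∧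
        ∀ h : 𝔉.HB, 𝔉.sCup ≫ (actT h).hom = (𝔉.strv (𝔉.autBaseIsoAB.symm (h : Aut (𝔉.base.obj 𝔉.BN)))).hom ≫ 𝔉.sCup := by
  haveI : Epi 𝔉.sCap := hepi _
  haveI : Epi 𝔉.sCup := hepi _
  constructor
  · rintro ⟨rfl, rfl⟩
    exact ⟨fun h => hcap h, fun h => hcup h⟩
  · rintro ⟨hS, hT⟩
    refine ⟨?_, ?_⟩
    · ext h : 1
      apply Aut.ext
      exact (cancel_epi 𝔉.sCap).mp ((hS h).trans (hcap h).symm)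
    · ext h : 1
      apply Aut.ext
      exact (cancel_epi 𝔉.sCup).mp ((hT h).trans (hcup h).symm)

/-- **Prop. 5.2 (ii) as a characterisation over abc-iut-L2-t4's bundle `Facts` of §5 named inputs** (its fields `sgpCapSpec`,
`sgpCupSpec`, `epi_sCap`, `epi_sCup` are exactly the hypotheses of the uniqueness argument), for consumers that carry `Facts` BY NAME
(cf. `Facts.sgpUnique`).  [cite: MochizukiEtTh2009, Prop 5.2 (ii) p.324 (PDF p.98); §5 p.331 (PDF p.105)] -/
theorem Facts.thetaPairActionsAgree_iff_definingRelations {𝔉 : ThetaFrobenioid.{w} C D} (H : 𝔉.Facts)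
    (actS actT : 𝔉.HB →* Aut 𝔉.BN) :
    ThetaPairActionsAgree 𝔉 actS actT ↔
      (∀ h : 𝔉.HB, 𝔉.sCap ≫ (actS h).hom = (𝔉.strv (𝔉.autBaseIsoAB.symm (h : Aut (𝔉.base.obj 𝔉.BN)))).hom ≫ 𝔉.sCap) ∧
        ∀ h : 𝔉.HB, 𝔉.sCup ≫ (actT h).hom = (𝔉.strv (𝔉.autBaseIsoAB.symm (h : Aut (𝔉.base.obj 𝔉.BN)))).hom ≫ 𝔉.sCup := by
  haveI := H.epi_sCap
  haveI := H.epi_sCup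
  constructor
  · rintro ⟨rfl, rfl⟩
    exact ⟨fun h => H.sgpCapSpec h, fun h => H.sgpCupSpec h⟩
  · rintro ⟨hS, hT⟩
    refine ⟨?_, ?_⟩
    · ext h : 1
      apply Aut.ext
      exact (cancel_epi 𝔉.sCap).mp ((hS h).trans (H.sgpCapSpec h).symm)
    · ext h : 1
      apply Aut.ext
      exact (cancel_epi 𝔉.sCup).mp ((hT h).trans (H.sgpCupSpec h).symm)

end Generic

/-! ### Prop. 5.2 (ii) for the assembled §5 data `ofBiKummerData` (any bi-Kummer setting) — unconditional -/

section BiKummerData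

variable {K : Type u₀} [Field K] {X : SemiGraphs.TemperedArithmeticGroup.{u₀} K} {D₀ : Type u₀} [Category.{v₀} D₀]
  {V : FrdIMonoidStub.{w}} {T₀ : RealifiedDivisorMonoids (D₀ := D₀) V} {D : Type u} [Category.{v} D]
  {VD : FrdICatStub.{u, v, w} D} {S : BiKummerSetting X T₀ D VD}
  {pullFrac : ∀ {A A' : S.C} (_ : A' ⟶ A), S.biratUnits A → S.biratUnits A'}
  {lv N : ℕ+} {T : ThetaEnvData.{max v w} N} {θ : S.biratUnits S.Aodot} {Bl : S.C}
  {Pl : S.FractionPair θ Bl} {Rl : S.NthRoot θ Pl lv pullFrac}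
  (h : ModelFrobenioid.Hypotheses S.tf.divisorMonoid S.tf.ratFnFunctor)
  (toB : ∀ A : S.C, S.biratUnits A →* S.tf.biratUnitsModel A) (Q : FrobenioidTheta.ThetaSubquotientStub.{w} D)
  (odd_l : Odd (lv : ℕ)) (R : S.NthRoot Rl.root Rl.pair N pullFrac) (ιX : T.PiX ≃ₜ* X.Pi)
  (hopen : IsOpen ((S.galoisSurj R.AN.base R.αData.isGalois).ker : Set X.Pi)) (σ : Aut R.AN.base →* Aut R.AN)
  (K' : Type w) [Field K'] (constEmb : K'ˣ →* S.tf.biratUnitsModel R.BN)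
  (constEmb_injective : Function.Injective constEmb)
  (hdivc : ∀ g : Aut R.BN.base,
    ModelFrobenioid.div ((σ ((BiKummerSetting.NthRoot.baseIso S R).conjAut.symm g)).hom ≫ R.pair.num) =
      ModelFrobenioid.div R.pair.num)
  (hdivp : ∀ y : T.PiYdd,
    ModelFrobenioid.div ((σ (S.galoisSurj R.AN.base R.αData.isGalois (ιX y.1))).hom ≫ R.pair.den) =
      ModelFrobenioid.div R.pair.den)

/-- **[EtTh] Prop. 5.2 (ii) for the assembled §5 data `ofBiKummerData`, as a characterisation, UNCONDITIONAL**: `s^⊓-gp_N`, `s^⊔-gp_N`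
of these data ARE the unique lifts of Prop. 4.3 (i) (p.331), so a pair of `H_{B_N}`-actions on `B_N` agrees with them iff it is
compatible with `s^⊓_N = s′_N`, `s^⊔_N = s″_N` (the root's fraction-pair); total epimorphicity = [FrdI] Thm. 5.2 for the model
Frobenioid (`epi_of_model`), defining relations = `sgpCapSpec_ofBiKummerData` / `sgpCupSpec_ofBiKummerData`.
[cite: MochizukiEtTh2009, Prop 5.2 (ii) p.324 (PDF p.98); §5 p.331 (PDF p.105)] -/
theorem thetaPairActionsAgree_ofBiKummerData_iff
    (actS actT : (ofBiKummerData h toB Q odd_l R ιX hopen σ K' constEmb constEmb_injective hdivc hdivp).HB →*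
      Aut (ofBiKummerData h toB Q odd_l R ιX hopen σ K' constEmb constEmb_injective hdivc hdivp).BN) :
    ThetaPairActionsAgree (ofBiKummerData h toB Q odd_l R ιX hopen σ K' constEmb constEmb_injective hdivc hdivp) actS actT ↔
      (∀ hh : (ofBiKummerData h toB Q odd_l R ιX hopen σ K' constEmb constEmb_injective hdivc hdivp).HB,
          (ofBiKummerData h toB Q odd_l R ιX hopen σ K' constEmb constEmb_injective hdivc hdivp).sCap ≫ (actS hh).hom =
            ((ofBiKummerData h toB Q odd_l R ιX hopen σ K' constEmb constEmb_injective hdivc hdivp).strv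
              ((ofBiKummerData h toB Q odd_l R ιX hopen σ K' constEmb constEmb_injective hdivc hdivp).autBaseIsoAB.symm
                (hh : Aut ((ofBiKummerData h toB Q odd_l R ιX hopen σ K' constEmb constEmb_injective hdivc hdivp).base.obj
                  (ofBiKummerData h toB Q odd_l R ιX hopen σ K' constEmb constEmb_injective hdivc hdivp).BN)))).hom ≫
              (ofBiKummerData h toB Q odd_l R ιX hopen σ K' constEmb constEmb_injective hdivc hdivp).sCap) ∧
        ∀ hh : (ofBiKummerData h toB Q odd_l R ιX hopen σ K' constEmb constEmb_injective hdivc hdivp).HB,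
          (ofBiKummerData h toB Q odd_l R ιX hopen σ K' constEmb constEmb_injective hdivc hdivp).sCup ≫ (actT hh).hom =
            ((ofBiKummerData h toB Q odd_l R ιX hopen σ K' constEmb constEmb_injective hdivc hdivp).strv
              ((ofBiKummerData h toB Q odd_l R ιX hopen σ K' constEmb constEmb_injective hdivc hdivp).autBaseIsoAB.symm
                (hh : Aut ((ofBiKummerData h toB Q odd_l R ιX hopen σ K' constEmb constEmb_injective hdivc hdivp).base.obj
                  (ofBiKummerData h toB Q odd_l R ιX hopen σ K' constEmb constEmb_injective hdivc hdivp).BN)))).hom ≫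
              (ofBiKummerData h toB Q odd_l R ιX hopen σ K' constEmb constEmb_injective hdivc hdivp).sCup :=
  thetaPairActionsAgree_iff_definingRelations_of_totallyEpi _ (epi_of_model (DivB := S.tf.divBNatTrans) h)
    (sgpCapSpec_ofBiKummerData h toB Q odd_l R ιX hopen σ K' constEmb constEmb_injective hdivc hdivp)
    (sgpCupSpec_ofBiKummerData h toB Q odd_l R ιX hopen σ K' constEmb constEmb_injective hdivc hdivp) actS actT

/-- **[EtTh] Prop. 5.2 (ii) for `ofBiKummerData`, direction "§1 ⟹ bi-Kummer"**: any pair of `H_{B_N}`-actions compatible with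
`s^⊓_N`, `s^⊔_N` IS `(s^⊓-gp_N|_{H_{B_N}}, s^⊔-gp_N)`; unconditional.  [cite: MochizukiEtTh2009, Prop 5.2 (ii) p.324 (PDF p.98); §5 p.331 (PDF p.105)] -/
theorem thetaPairActionsAgree_ofBiKummerData_of_definingRelations
    (actS actT : (ofBiKummerData h toB Q odd_l R ιX hopen σ K' constEmb constEmb_injective hdivc hdivp).HB →*
      Aut (ofBiKummerData h toB Q odd_l R ιX hopen σ K' constEmb constEmb_injective hdivc hdivp).BN)
    (hS : ∀ hh : (ofBiKummerData h toB Q odd_l R ιX hopen σ K' constEmb constEmb_injective hdivc hdivp).HB,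
      (ofBiKummerData h toB Q odd_l R ιX hopen σ K' constEmb constEmb_injective hdivc hdivp).sCap ≫ (actS hh).hom =
        ((ofBiKummerData h toB Q odd_l R ιX hopen σ K' constEmb constEmb_injective hdivc hdivp).strv
          ((ofBiKummerData h toB Q odd_l R ιX hopen σ K' constEmb constEmb_injective hdivc hdivp).autBaseIsoAB.symm
            (hh : Aut ((ofBiKummerData h toB Q odd_l R ιX hopen σ K' constEmb constEmb_injective hdivc hdivp).base.obj
              (ofBiKummerData h toB Q odd_l R ιX hopen σ K' constEmb constEmb_injective hdivc hdivp).BN)))).hom ≫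
          (ofBiKummerData h toB Q odd_l R ιX hopen σ K' constEmb constEmb_injective hdivc hdivp).sCap)
    (hT : ∀ hh : (ofBiKummerData h toB Q odd_l R ιX hopen σ K' constEmb constEmb_injective hdivc hdivp).HB,
      (ofBiKummerData h toB Q odd_l R ιX hopen σ K' constEmb constEmb_injective hdivc hdivp).sCup ≫ (actT hh).hom =
        ((ofBiKummerData h toB Q odd_l R ιX hopen σ K' constEmb constEmb_injective hdivc hdivp).strv
          ((ofBiKummerData h toB Q odd_l R ιX hopen σ K' constEmb constEmb_injective hdivc hdivp).autBaseIsoAB.symm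
            (hh : Aut ((ofBiKummerData h toB Q odd_l R ιX hopen σ K' constEmb constEmb_injective hdivc hdivp).base.obj
              (ofBiKummerData h toB Q odd_l R ιX hopen σ K' constEmb constEmb_injective hdivc hdivp).BN)))).hom ≫
          (ofBiKummerData h toB Q odd_l R ιX hopen σ K' constEmb constEmb_injective hdivc hdivp).sCup) :
    ThetaPairActionsAgree (ofBiKummerData h toB Q odd_l R ιX hopen σ K' constEmb constEmb_injective hdivc hdivp) actS actT :=
  (thetaPairActionsAgree_ofBiKummerData_iff h toB Q odd_l R ιX hopen σ K' constEmb constEmb_injective hdivc hdivp actS actT).2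
    ⟨hS, hT⟩

end BiKummerData

/-! ### Prop. 5.2 (ii) for the §5 data over the GENUINE connected base `B^temp(Π^tp_X)⁰` -/

section ConnectedTemperoid

variable {K : Type u₀} [Field K] {X : SemiGraphs.TemperedArithmeticGroup.{u₀} K} {D₀ : Type u₀} [Category.{v₀} D₀]
  {V : FrdIMonoidStub.{w}} {T₀ : RealifiedDivisorMonoids (D₀ := D₀) V}
  {VD : FrdICatStub.{u₀ + 1, u₀, w} (ConnectedPart (BTemp X.Pi))}
  {tf : TemperedFrobenioid T₀ (ConnectedPart (BTemp X.Pi)) VD} {hZ : tf.monoidType = MonoidType.Z}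
  {hP : ∀ A : (ConnectedPart (BTemp X.Pi))ᵒᵖ, IsPerfect (tf.Φ.carrier A)}
  {NH : Subgroup (Field.absoluteGaloisGroup K) → tf.category → ℕ+ → Prop} {A₀ : tf.category}
  {hA₀ : PreFrobenioid.IsFrobeniusTrivial tf.toElem A₀} {hA₀' : SemiGraphs.IsGaloisObj A₀.base.obj}
  {pullFrac : ∀ {A A' : (BiKummerSetting.mkOfConnectedTemperoid X tf hZ hP NH A₀ hA₀ hA₀').C} (_ : A' ⟶ A),
    (BiKummerSetting.mkOfConnectedTemperoid X tf hZ hP NH A₀ hA₀ hA₀').biratUnits A →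
      (BiKummerSetting.mkOfConnectedTemperoid X tf hZ hP NH A₀ hA₀ hA₀').biratUnits A'}
  {lv N : ℕ+} {T : ThetaEnvData.{max u₀ w} N}
  {θ : (BiKummerSetting.mkOfConnectedTemperoid X tf hZ hP NH A₀ hA₀ hA₀').biratUnits
    (BiKummerSetting.mkOfConnectedTemperoid X tf hZ hP NH A₀ hA₀ hA₀').Aodot}
  {Bl : (BiKummerSetting.mkOfConnectedTemperoid X tf hZ hP NH A₀ hA₀ hA₀').C}
  {Pl : (BiKummerSetting.mkOfConnectedTemperoid X tf hZ hP NH A₀ hA₀ hA₀').FractionPair θ Bl}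
  {Rl : (BiKummerSetting.mkOfConnectedTemperoid X tf hZ hP NH A₀ hA₀ hA₀').NthRoot θ Pl lv pullFrac}
  (h : ModelFrobenioid.Hypotheses tf.divisorMonoid tf.ratFnFunctor)
  (Q : FrobenioidTheta.ThetaSubquotientStub.{w} (ConnectedPart (BTemp X.Pi))) (odd_l : Odd (lv : ℕ))
  (R : (BiKummerSetting.mkOfConnectedTemperoid X tf hZ hP NH A₀ hA₀ hA₀').NthRoot Rl.root Rl.pair N pullFrac)
  (ιX : T.PiX ≃ₜ* X.Pi) (K' : Type w) [Field K'] (constEmb : K'ˣ →* tf.biratUnitsModel R.BN)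
  (constEmb_injective : Function.Injective constEmb)
  (hinvc : ∀ g : Aut R.AN.base,
    pull tf.divisorMonoid g.hom (ModelFrobenioid.div R.pair.num) = ModelFrobenioid.div R.pair.num)
  (hinvp : ∀ y : T.PiX, y ∈ T.PiYdd →
    pull tf.divisorMonoid ((BiKummerSetting.mkOfConnectedTemperoid X tf hZ hP NH A₀ hA₀ hA₀').galoisSurj R.AN.base
      R.αData.isGalois (ιX y)).hom (ModelFrobenioid.div R.pair.den) = ModelFrobenioid.div R.pair.den)

/-- **[EtTh] Prop. 5.2 (ii) for the §5 data over the GENUINE connected base `B^temp(Π^tp_X)⁰`, as a characterisation, UNCONDITIONAL**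
(p.324 (PDF p.98); `s^trv_N = strvOfBiKummerData h R` constructed, `(s^⊓_N, s^⊔_N) = (R.pair.num, R.pair.den)`): a pair `(actS, actT)` of
`H_{B_N}`-actions on `B_N` — the slots for the Frobenioid incarnation of the actions of Prop. 1.1 (ii) / Lem. 1.2 — agrees with "the
actions determined by the bi-Kummer `l·N`-th root [cf. Proposition 4.3, (i)]" IFF it is compatible with the morphisms `s^⊓_N`, `s^⊔_N`
determined by `s_{l·N}`, `τ_{l·N}` (their §1 defining properties read in `C`).  No named fact, no GAP row.
[cite: MochizukiEtTh2009, Prop 5.2 (ii) p.324 (PDF p.98); §5 p.331 (PDF p.105)] -/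
theorem thetaPairActionsAgree_ofConnectedTemperoidData_iff
    (actS actT : (ofConnectedTemperoidData h Q odd_l R ιX K' constEmb constEmb_injective hinvc hinvp).HB →*
      Aut (ofConnectedTemperoidData h Q odd_l R ιX K' constEmb constEmb_injective hinvc hinvp).BN) :
    ThetaPairActionsAgree (ofConnectedTemperoidData h Q odd_l R ιX K' constEmb constEmb_injective hinvc hinvp) actS actT ↔
      (∀ hh : (ofConnectedTemperoidData h Q odd_l R ιX K' constEmb constEmb_injective hinvc hinvp).HB,
          (ofConnectedTemperoidData h Q odd_l R ιX K' constEmb constEmb_injective hinvc hinvp).sCap ≫ (actS hh).hom =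
            ((ofConnectedTemperoidData h Q odd_l R ιX K' constEmb constEmb_injective hinvc hinvp).strv
              ((ofConnectedTemperoidData h Q odd_l R ιX K' constEmb constEmb_injective hinvc hinvp).autBaseIsoAB.symm
                (hh : Aut ((ofConnectedTemperoidData h Q odd_l R ιX K' constEmb constEmb_injective hinvc hinvp).base.obj
                  (ofConnectedTemperoidData h Q odd_l R ιX K' constEmb constEmb_injective hinvc hinvp).BN)))).hom ≫
              (ofConnectedTemperoidData h Q odd_l R ιX K' constEmb constEmb_injective hinvc hinvp).sCap) ∧
        ∀ hh : (ofConnectedTemperoidData h Q odd_l R ιX K' constEmb constEmb_injective hinvc hinvp).HB,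
          (ofConnectedTemperoidData h Q odd_l R ιX K' constEmb constEmb_injective hinvc hinvp).sCup ≫ (actT hh).hom =
            ((ofConnectedTemperoidData h Q odd_l R ιX K' constEmb constEmb_injective hinvc hinvp).strv
              ((ofConnectedTemperoidData h Q odd_l R ιX K' constEmb constEmb_injective hinvc hinvp).autBaseIsoAB.symm
                (hh : Aut ((ofConnectedTemperoidData h Q odd_l R ιX K' constEmb constEmb_injective hinvc hinvp).base.obj
                  (ofConnectedTemperoidData h Q odd_l R ιX K' constEmb constEmb_injective hinvc hinvp).BN)))).hom ≫
              (ofConnectedTemperoidData h Q odd_l R ιX K' constEmb constEmb_injective hinvc hinvp).sCup :=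
  thetaPairActionsAgree_iff_definingRelations_of_totallyEpi _ (epi_of_model (DivB := tf.divBNatTrans) h)
    (sgpCapSpec_ofConnectedTemperoidData h Q odd_l R ιX K' constEmb constEmb_injective hinvc hinvp)
    (sgpCupSpec_ofConnectedTemperoidData h Q odd_l R ιX K' constEmb constEmb_injective hinvc hinvp) actS actT

/-- **[EtTh] Prop. 5.2 (ii) over `B^temp(Π^tp_X)⁰`, direction "§1 ⟹ bi-Kummer"**: any pair of `H_{B_N}`-actions on `B_N` compatible with
`s^⊓_N`, `s^⊔_N` IS the bi-Kummer pair `(s^⊓-gp_N|_{H_{B_N}}, s^⊔-gp_N)` of the genuine §5 data; unconditional.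
[cite: MochizukiEtTh2009, Prop 5.2 (ii) p.324 (PDF p.98); §5 p.331 (PDF p.105)] -/
theorem thetaPairActionsAgree_ofConnectedTemperoidData_of_definingRelations
    (actS actT : (ofConnectedTemperoidData h Q odd_l R ιX K' constEmb constEmb_injective hinvc hinvp).HB →*
      Aut (ofConnectedTemperoidData h Q odd_l R ιX K' constEmb constEmb_injective hinvc hinvp).BN)
    (hS : ∀ hh : (ofConnectedTemperoidData h Q odd_l R ιX K' constEmb constEmb_injective hinvc hinvp).HB,
      (ofConnectedTemperoidData h Q odd_l R ιX K' constEmb constEmb_injective hinvc hinvp).sCap ≫ (actS hh).hom =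
        ((ofConnectedTemperoidData h Q odd_l R ιX K' constEmb constEmb_injective hinvc hinvp).strv
          ((ofConnectedTemperoidData h Q odd_l R ιX K' constEmb constEmb_injective hinvc hinvp).autBaseIsoAB.symm
            (hh : Aut ((ofConnectedTemperoidData h Q odd_l R ιX K' constEmb constEmb_injective hinvc hinvp).base.obj
              (ofConnectedTemperoidData h Q odd_l R ιX K' constEmb constEmb_injective hinvc hinvp).BN)))).hom ≫
          (ofConnectedTemperoidData h Q odd_l R ιX K' constEmb constEmb_injective hinvc hinvp).sCap)
    (hT : ∀ hh : (ofConnectedTemperoidData h Q odd_l R ιX K' constEmb constEmb_injective hinvc hinvp).HB,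
      (ofConnectedTemperoidData h Q odd_l R ιX K' constEmb constEmb_injective hinvc hinvp).sCup ≫ (actT hh).hom =
        ((ofConnectedTemperoidData h Q odd_l R ιX K' constEmb constEmb_injective hinvc hinvp).strv
          ((ofConnectedTemperoidData h Q odd_l R ιX K' constEmb constEmb_injective hinvc hinvp).autBaseIsoAB.symm
            (hh : Aut ((ofConnectedTemperoidData h Q odd_l R ιX K' constEmb constEmb_injective hinvc hinvp).base.obj
              (ofConnectedTemperoidData h Q odd_l R ιX K' constEmb constEmb_injective hinvc hinvp).BN)))).hom ≫
          (ofConnectedTemperoidData h Q odd_l R ιX K' constEmb constEmb_injective hinvc hinvp).sCup) :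
    ThetaPairActionsAgree (ofConnectedTemperoidData h Q odd_l R ιX K' constEmb constEmb_injective hinvc hinvp) actS actT :=
  (thetaPairActionsAgree_ofConnectedTemperoidData_iff h Q odd_l R ιX K' constEmb constEmb_injective hinvc hinvp actS actT).2
    ⟨hS, hT⟩

/-- Over `B^temp(Π^tp_X)⁰` the Prop. 1.1 (ii) action in its full-group form — a homomorphism `a : Aut_D(B_N^bs) → Aut_C(B_N)` (the
action "factors through `Gal(Z_N/X)`") compatible with `s^⊓_N` — IS `s^⊓-gp_N` of the genuine §5 data; unconditional.
[cite: MochizukiEtTh2009, Prop 5.2 (ii) p.324 (PDF p.98); Prop 1.1 (ii) p.241 (PDF p.15); §5 p.331 (PDF p.105)] -/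
theorem eq_sgpCap_ofConnectedTemperoidData_of_comp_eq
    (a : Aut ((ofConnectedTemperoidData h Q odd_l R ιX K' constEmb constEmb_injective hinvc hinvp).base.obj
        (ofConnectedTemperoidData h Q odd_l R ιX K' constEmb constEmb_injective hinvc hinvp).BN) →*
      Aut (ofConnectedTemperoidData h Q odd_l R ιX K' constEmb constEmb_injective hinvc hinvp).BN)
    (ha : ∀ g : Aut ((ofConnectedTemperoidData h Q odd_l R ιX K' constEmb constEmb_injective hinvc hinvp).base.obj
        (ofConnectedTemperoidData h Q odd_l R ιX K' constEmb constEmb_injective hinvc hinvp).BN),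
      (ofConnectedTemperoidData h Q odd_l R ιX K' constEmb constEmb_injective hinvc hinvp).sCap ≫ (a g).hom =
        ((ofConnectedTemperoidData h Q odd_l R ιX K' constEmb constEmb_injective hinvc hinvp).strv
          ((ofConnectedTemperoidData h Q odd_l R ιX K' constEmb constEmb_injective hinvc hinvp).autBaseIsoAB.symm g)).hom ≫
          (ofConnectedTemperoidData h Q odd_l R ιX K' constEmb constEmb_injective hinvc hinvp).sCap) :
    a = (ofConnectedTemperoidData h Q odd_l R ιX K' constEmb constEmb_injective hinvc hinvp).sgpCap :=
  haveI : Epi (ofConnectedTemperoidData h Q odd_l R ιX K' constEmb constEmb_injective hinvc hinvp).sCap :=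
    epi_of_model (DivB := tf.divBNatTrans) h _
  eq_sgpCap_of_comp_eq _ (sgpCapSpec_ofConnectedTemperoidData h Q odd_l R ιX K' constEmb constEmb_injective hinvc hinvp) a ha

end ConnectedTemperoid

end ThetaFrobenioid

end Literature.AnabelianGeometry.EtaleTheta

end
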